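import Summits.AtomisticToContinuum.Crystallization.Theorems.FreeSplittingCertificatesStrictSplittingRuleFarPencilIntegral

/-!
# `StrictSplittingRule` (stmt-AtomisticToContinuum-12560): the integrated far pencil for NON-compactly-supported fields — integrability form

Route `FreeSplittingCertificates`, crux r3 `StrictSplittingRule` (H12⋆ = `stub_coreJointCoercive`), unit b2b-freesplit-B gen 10.
VALUE = the form of `farPencil_integral_le` that the far-field class of the H12⋆ architecture actually needs — NOT a proof of H12⋆, NOT summit progress.

Outside the support of the lattice displacement the co-rotated far field is AFFINE (`v = −u_P − W(y − y_P)`, `W` skew; HOME FAR-LEMMA-SPEC §7 (f)(iv)), so it is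
NOT compactly supported, but all far densities still decay like `|x|⁻⁶` and are integrable.  `…FarPencilIntegral` used compact support only to obtain integrability and
the line derivatives of the flux.  Here the same chain is run under the hypotheses it really uses:

**`farPencil_integral_le_of_integrable`**: if `v ∈ C²(ℝ³; ℝ³)` vanishes near the reference site (`v =ᶠ[𝓝 0] 0`) and the four densities along `v` — demand `fpNum`,
receipts `fpDen`, flux `Φⱼ = fpFlux v · j` and `∂ⱼΦⱼ = fpFluxDeriv v · j j` — are integrable, then `∫ Num ≤ (17/200)∫ Den` (and `∫ div Φ = 0`, `integral_fpDivFlux_eq_zero'`).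
Mathlib's integration by parts for line derivatives needs exactly integrability, not compact support.  HONEST FRAMING: theorem about test fields; the verification of the
integrability hypotheses for the affine-tail class, the lattice transfer and the near certificate are not here; NOT a proof of H12⋆, NOT summit progress.
-/

noncomputable section

open MeasureTheory Topology Filter

namespace Summit.AtomisticToContinuum.Crystallization.Theorems.StrictSplittingRuleBirth

variable {v : (Fin 3 → ℝ) → (Fin 3 → ℝ)}

/-- A field vanishing near `y` has vanishing gradient near `y`. -/
theorem fp_fderiv_eventuallyEq_zero {y : Fin 3 → ℝ} (h0 : v =ᶠ[𝓝 y] 0) : fderiv ℝ v =ᶠ[𝓝 y] 0 := by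
  have h := h0.fderiv (𝕜 := ℝ)
  rw [fderiv_zero] at h
  exact h

/-- A field vanishing near `y`: `v y = 0`, `∇v(y) = 0`, `∇²v(y) = 0`. -/
theorem fp_vanish_at {y : Fin 3 → ℝ} (h0 : v =ᶠ[𝓝 y] 0) :
    v y = 0 ∧ fderiv ℝ v y = 0 ∧ fderiv ℝ (fderiv ℝ v) y = 0 := by
  have h1 := fp_fderiv_eventuallyEq_zero h0
  refine ⟨h0.self_of_nhds, h1.self_of_nhds, ?_⟩
  have h2 := h1.fderiv (𝕜 := ℝ)
  rw [fderiv_zero] at h2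
  exact h2.self_of_nhds

/-- The flux vanishes near a point where the field vanishes locally. -/
theorem fpFlux_eventuallyEq_zero {y : Fin 3 → ℝ} (h0 : v =ᶠ[𝓝 y] 0) (j : Fin 3) :
    (fun z => fpFlux v z j) =ᶠ[𝓝 y] fun _ => (0 : ℝ) := by
  filter_upwards [h0.eventuallyEq_nhds] with z hz
  have h := fp_vanish_at hz
  exact fpFlux_eq_zero h.1 h.2.1 j

/-- `∂ₖΦⱼ = fpFluxDeriv` EVERYWHERE for a `C²` field vanishing near `0` (no support hypothesis). -/
theorem hasLineDerivAt_fpFlux_all' (hv : ContDiff ℝ 2 v) (h0 : v =ᶠ[𝓝 0] 0) (j k : Fin 3) (y : Fin 3 → ℝ) :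
    HasLineDerivAt ℝ (fun z => fpFlux v z j) (fpFluxDeriv v y j k) y (fpE k) := by
  by_cases hy : y = 0
  · subst hy
    have h := fp_vanish_at h0
    rw [fpFluxDeriv_eq_zero h.1 h.2.1 h.2.2, (fpFlux_eventuallyEq_zero h0 j).hasLineDerivAt_iff]
    show HasDerivAt (fun _ : ℝ => (0 : ℝ)) 0 0
    exact hasDerivAt_const _ _
  · have h1 : ContDiff ℝ 1 (fderiv ℝ v) := hv.fderiv_right (by norm_num)
    exact hasLineDerivAt_fpFlux hy (hv.differentiable (by simp) y) (h1.differentiable (by simp) y) j k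

/-- `div Φ = fpDivFlux` EVERYWHERE for a `C²` field vanishing near `0`. -/
theorem fpDivFlux_eq_sum_fpFluxDeriv' (hv : ContDiff ℝ 2 v) (h0 : v =ᶠ[𝓝 0] 0) (y : Fin 3 → ℝ) :
    fpDivFlux y (v y) (fpGrad v y) = fpFluxDeriv v y 0 0 + fpFluxDeriv v y 1 1 + fpFluxDeriv v y 2 2 := by
  by_cases hy : y = 0
  · subst hy
    have h := fp_vanish_at h0
    rw [fpFluxDeriv_eq_zero h.1 h.2.1 h.2.2, fpFluxDeriv_eq_zero h.1 h.2.1 h.2.2, fpFluxDeriv_eq_zero h.1 h.2.1 h.2.2]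
    simp [fpDivFlux, fpGrad, h.1, h.2.1, fpDot, fpTr, fpTrSq, fpXGV, fpVGX]
  · exact (sum_fpFluxDeriv_eq_fpDivFlux_of_contDiffAt v hy hv.contDiffAt).symm

/-- **`∫ ∂ⱼΦⱼ = 0`** under integrability only. -/
theorem integral_fpFluxDeriv_eq_zero' (hv : ContDiff ℝ 2 v) (h0 : v =ᶠ[𝓝 0] 0)
    (iΦ : ∀ j, Integrable fun y => fpFlux v y j) (iΦ' : ∀ j, Integrable fun y => fpFluxDeriv v y j j) (j : Fin 3) :
    ∫ y, fpFluxDeriv v y j j = 0 := by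
  have h := integral_bilinear_hasLineDerivAt_right_eq_neg_left_of_integrable
    (μ := (volume : Measure (Fin 3 → ℝ))) (B := ContinuousLinearMap.mul ℝ ℝ) (v := fpE j)
    (f := fun z => fpFlux v z j) (f' := fun y => fpFluxDeriv v y j j)
    (g := fun _ => (1 : ℝ)) (g' := fun _ => (0 : ℝ))
    (by simpa using iΦ' j) (by simp) (by simpa using iΦ j)
    (fun y _ => hasLineDerivAt_fpFlux_all' hv h0 j j y)
    (fun y _ => by
      show HasDerivAt (fun _ : ℝ => (1 : ℝ)) 0 0
      exact hasDerivAt_const _ _)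
  simpa using h

/-- `fpDivFlux` along the field is integrable (sum of the three `∂ⱼΦⱼ`). -/
theorem integrable_fpDivFlux' (hv : ContDiff ℝ 2 v) (h0 : v =ᶠ[𝓝 0] 0)
    (iΦ' : ∀ j, Integrable fun y => fpFluxDeriv v y j j) : Integrable fun y => fpDivFlux y (v y) (fpGrad v y) := by
  have h : (fun y => fpDivFlux y (v y) (fpGrad v y)) =
      fun y => fpFluxDeriv v y 0 0 + fpFluxDeriv v y 1 1 + fpFluxDeriv v y 2 2 :=
    funext (fpDivFlux_eq_sum_fpFluxDeriv' hv h0)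
  rw [h]
  exact ((iΦ' 0).add (iΦ' 1)).add (iΦ' 2)

/-- **`∫ div Φ = 0`** under integrability only. -/
theorem integral_fpDivFlux_eq_zero' (hv : ContDiff ℝ 2 v) (h0 : v =ᶠ[𝓝 0] 0)
    (iΦ : ∀ j, Integrable fun y => fpFlux v y j) (iΦ' : ∀ j, Integrable fun y => fpFluxDeriv v y j j) :
    ∫ y, fpDivFlux y (v y) (fpGrad v y) = 0 := by
  have h : (fun y => fpDivFlux y (v y) (fpGrad v y)) =
      fun y => fpFluxDeriv v y 0 0 + fpFluxDeriv v y 1 1 + fpFluxDeriv v y 2 2 :=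
    funext (fpDivFlux_eq_sum_fpFluxDeriv' hv h0)
  have e1 : ∫ y, (fpFluxDeriv v y 0 0 + fpFluxDeriv v y 1 1 + fpFluxDeriv v y 2 2) =
      (∫ y, (fpFluxDeriv v y 0 0 + fpFluxDeriv v y 1 1)) + ∫ y, fpFluxDeriv v y 2 2 :=
    integral_add ((iΦ' 0).add (iΦ' 1)) (iΦ' 2)
  have e2 : ∫ y, (fpFluxDeriv v y 0 0 + fpFluxDeriv v y 1 1) =
      (∫ y, fpFluxDeriv v y 0 0) + ∫ y, fpFluxDeriv v y 1 1 := integral_add (iΦ' 0) (iΦ' 1)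
  rw [h, e1, e2, integral_fpFluxDeriv_eq_zero' hv h0 iΦ iΦ' 0, integral_fpFluxDeriv_eq_zero' hv h0 iΦ iΦ' 1,
    integral_fpFluxDeriv_eq_zero' hv h0 iΦ iΦ' 2]
  ring

/-- **THE CONTINUUM FAR PENCIL, INTEGRABILITY FORM.**  For every `C²` field `v : ℝ³ → ℝ³` vanishing near the reference site whose demand, receipts, flux
and flux-derivative densities are integrable: `∫ fpNum x (v x) (∇v x) ≤ (17/200)·∫ fpDen x (∇v x)`.  Covers non-compactly-supported far fields (affine tails)
once their `|x|⁻⁶` decay is checked.  NOT a proof of H12⋆, NOT summit progress. -/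
theorem farPencil_integral_le_of_integrable (hv : ContDiff ℝ 2 v) (h0 : v =ᶠ[𝓝 0] 0)
    (iN : Integrable fun y => fpNum y (v y) (fpGrad v y)) (iD : Integrable fun y => fpDen y (fpGrad v y))
    (iΦ : ∀ j, Integrable fun y => fpFlux v y j) (iΦ' : ∀ j, Integrable fun y => fpFluxDeriv v y j j) :
    ∫ x, fpNum x (v x) (fpGrad v x) ≤ 17 / 200 * ∫ x, fpDen x (fpGrad v x) := by
  have hΦ := integrable_fpDivFlux' hv h0 iΦ'
  have h1 : ∫ x, fpNum x (v x) (fpGrad v x) =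
      ∫ x, (fpNum x (v x) (fpGrad v x) + 1 / 18 * fpDivFlux x (v x) (fpGrad v x)) := by
    rw [integral_add iN (hΦ.const_mul _), integral_const_mul, integral_fpDivFlux_eq_zero' hv h0 iΦ iΦ']
    ring
  have h2 : ∫ x, (fpNum x (v x) (fpGrad v x) + 1 / 18 * fpDivFlux x (v x) (fpGrad v x)) ≤
      ∫ x, 17 / 200 * fpDen x (fpGrad v x) :=
    integral_mono (iN.add (hΦ.const_mul _)) (iD.const_mul _) fun x => farPencil_pointwise_le' x (v x) (fpGrad v x)
  rw [h1]
  refine h2.trans_eq ?_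
  exact integral_const_mul _ _

end Summit.AtomisticToContinuum.Crystallization.Theorems.StrictSplittingRuleBirth
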